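/-
Seat 2 (crux-ideate ⟨stmt-QuantumFields-10604⟩ `DiagonalMirrorRPR`, lens: comparison inequalities) — first lemmas
for the annex card `wrong-sign-seam-domination` (merged into `sign-twisted-diagonal-trace`).
Finite-dimensional matrix form; the lattice operators are Hilbert–Schmidt integral operators on
`L²(G^{links of a diagonal slab})` with the same algebra.  No `sorry`: proved lemmas are `theorem`s,
the two unproved statements of the line are `def … : Prop`.
-/
import Mathlib

open Filter Topology Matrix BigOperators

namespace Summit.QuantumFields.YangMills.Cruxes.DiagonalMirrorRPR.WrongSignAnnex

section HatSymmetry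
/-! ### 1. Θ-pseudo-symmetric half steps (gauge-slab e₀-step).
On the diagonal slab state `y = (V, W)` the e₀-translation is a product of two Markov half-steps `𝒜` (update the
site slab) and `𝓑` (update the link slab); each satisfies `Xᵀ = Θ X Θ` for the link-label involution
`Θ : A_s ↔ B_s`.  Then `Â := 𝒜 Θ`, `B̂ := Θ 𝓑` are symmetric, `𝒜 𝓑 = Â B̂`, and every odd palindrome
`(Â B̂)^m Â` — in particular the SEAM BLOCK of an odd torus — is symmetric, hence has a spectral sign
decomposition.  (`B̂` is the Schur cut of the `(01)` plaquettes: PSD iff `β ≥ 0`; toy check `toys/z2gauge.out`.) -/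

variable {n : Type*} [Fintype n] [DecidableEq n]

theorem mul_invol_isSymm (A Θ : Matrix n n ℝ) (hΘt : Θᵀ = Θ) (hΘ2 : Θ * Θ = 1)
    (hA : Aᵀ = Θ * A * Θ) : (A * Θ)ᵀ = A * Θ := by
  calc (A * Θ)ᵀ = Θᵀ * Aᵀ := Matrix.transpose_mul _ _
    _ = Θ * (Θ * A * Θ) := by rw [hΘt, hA]
    _ = (Θ * Θ) * (A * Θ) := by simp only [Matrix.mul_assoc]
    _ = A * Θ := by rw [hΘ2, Matrix.one_mul]

theorem invol_mul_isSymm (B Θ : Matrix n n ℝ) (hΘt : Θᵀ = Θ) (hΘ2 : Θ * Θ = 1)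
    (hB : Bᵀ = Θ * B * Θ) : (Θ * B)ᵀ = Θ * B := by
  calc (Θ * B)ᵀ = Bᵀ * Θᵀ := Matrix.transpose_mul _ _
    _ = (Θ * B * Θ) * Θ := by rw [hΘt, hB]
    _ = (Θ * B) * (Θ * Θ) := by simp only [Matrix.mul_assoc]
    _ = Θ * B := by rw [hΘ2, Matrix.mul_one]

theorem step_eq_hat_mul_hat (A B Θ : Matrix n n ℝ) (hΘ2 : Θ * Θ = 1) :
    A * B = (A * Θ) * (Θ * B) := by
  calc A * B = A * (Θ * Θ) * B := by rw [hΘ2, Matrix.mul_one]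
    _ = (A * Θ) * (Θ * B) := by simp only [Matrix.mul_assoc]

/-- An odd palindrome `(P Q)^m P` in two symmetric letters is symmetric. -/
theorem palindrome_isSymm (P Q : Matrix n n ℝ) (hP : Pᵀ = P) (hQ : Qᵀ = Q) (m : ℕ) :
    ((P * Q) ^ m * P)ᵀ = (P * Q) ^ m * P := by
  have hsc : SemiconjBy P (Q * P) (P * Q) := by
    simp only [SemiconjBy, Matrix.mul_assoc]
  have h := hsc.pow_right m
  rw [Matrix.transpose_mul, Matrix.transpose_pow, Matrix.transpose_mul, hP, hQ]
  exact h.eq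

/-- The seam block `(𝒜 𝓑)^m 𝒜 Θ` of an odd chain of Θ-pseudo-symmetric half steps is symmetric. PROVED. -/
theorem seamBlock_isSymm (A B Θ : Matrix n n ℝ) (hΘt : Θᵀ = Θ) (hΘ2 : Θ * Θ = 1)
    (hA : Aᵀ = Θ * A * Θ) (hB : Bᵀ = Θ * B * Θ) (m : ℕ) :
    ((A * B) ^ m * (A * Θ))ᵀ = (A * B) ^ m * (A * Θ) := by
  rw [step_eq_hat_mul_hat A B Θ hΘ2]
  exact palindrome_isSymm (A * Θ) (Θ * B) (mul_invol_isSymm A Θ hΘt hΘ2 hA)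
    (invol_mul_isSymm B Θ hΘt hΘ2 hB) m

end HatSymmetry

section WrongSign
/-! ### 2. Wrong-sign weight and the domination inequality (statements of the line).
For a real symmetric `H` (the symmetrised e₀-step / seam generator) with eigenpairs `(κᵥ, v)` and an
insertion matrix `C` (observable `F` on the first layers times the propagation to them):
`Tr(C H^m Cᵀ) = Σᵥ κᵥ^m ‖Cᵀ v‖² = P_m(C) − N_m(C)` with `N_m(C) := Σ_{κᵥ<0} |κᵥ|^m ‖Cᵀv‖² ≥ 0` for odd `m`
(odd torus ⇒ odd `m`), while for even exponent `Tr(C H^{2j} Cᵀ) = ‖H^j Cᵀ‖²_HS ≥ 0` is the pairing on the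
tilted (RP) torus of half length `j`.  Splitting `m = m₁ + 2m₂`:
`N_m(C) ≤ (max_{κᵥ<0}|κᵥ|)^{m₁} · Tr(C H^{2m₂} Cᵀ)` — the comparison inequality (★) of the card. -/

variable {d : ℕ}

/-- weight of `C` on the eigenvector `i` of `H`: `‖Cᵀ vᵢ‖²`. -/
noncomputable def evWeight {H : Matrix (Fin d) (Fin d) ℝ} (hH : H.IsHermitian)
    (C : Matrix (Fin d) (Fin d) ℝ) (i : Fin d) : ℝ :=
  ∑ j, ((Cᵀ *ᵥ ⇑(hH.eigenvectorBasis i)) j) ^ 2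

/-- the WRONG-SIGN weight `N_m(C) = Σ_{κᵢ<0} |κᵢ|^m ‖Cᵀvᵢ‖²`. -/
noncomputable def wrongSignWeight {H : Matrix (Fin d) (Fin d) ℝ} (hH : H.IsHermitian)
    (C : Matrix (Fin d) (Fin d) ℝ) (m : ℕ) : ℝ :=
  ∑ i, if hH.eigenvalues i < 0 then |hH.eigenvalues i| ^ m * evWeight hH C i else 0

/-- the RIGHT-SIGN weight `P_m(C) = Σ_{κᵢ ≥ 0} κᵢ^m ‖Cᵀvᵢ‖²`. -/
noncomputable def rightSignWeight {H : Matrix (Fin d) (Fin d) ℝ} (hH : H.IsHermitian)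
    (C : Matrix (Fin d) (Fin d) ℝ) (m : ℕ) : ℝ :=
  ∑ i, if hH.eigenvalues i < 0 then 0 else hH.eigenvalues i ^ m * evWeight hH C i

/-- FIRST LEMMA (a), the sign-split trace identity for odd exponent:
`Tr(C H^m Cᵀ) = P_m(C) − N_m(C)`, both parts `≥ 0`.  (Spectral theorem
`Matrix.IsHermitian.spectral_theorem`; routine.) -/
def SignSplitTrace : Prop :=
  ∀ (d : ℕ) (H C : Matrix (Fin d) (Fin d) ℝ) (hH : H.IsHermitian) (m : ℕ), Odd m →
    Matrix.trace (C * H ^ m * Cᵀ) = rightSignWeight hH C m - wrongSignWeight hH C m ∧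
      0 ≤ rightSignWeight hH C m ∧ 0 ≤ wrongSignWeight hH C m

/-- FIRST LEMMA (b), the comparison inequality (★): for `0 ≤ r` dominating the wrong-sign spectrum
(`κᵢ < 0 → |κᵢ| ≤ r`) and a split `m₁ + 2 m₂`,
`N_{m₁+2m₂}(C) ≤ r^{m₁} · Tr(C H^{2m₂} Cᵀ)`; the right-hand trace is the (manifestly nonnegative) pairing on the
tilted torus of half length `m₂`.  (Termwise: `|κᵢ|^{m₁+2m₂} w ≤ r^{m₁} κᵢ^{2m₂} w`, then add the `κᵢ ≥ 0` terms.) -/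
def WrongSignDomination : Prop :=
  ∀ (d : ℕ) (H C : Matrix (Fin d) (Fin d) ℝ) (hH : H.IsHermitian) (r : ℝ) (m₁ m₂ : ℕ), 0 ≤ r →
    (∀ i, hH.eigenvalues i < 0 → |hH.eigenvalues i| ≤ r) →
      wrongSignWeight hH C (m₁ + 2 * m₂) ≤ r ^ m₁ * Matrix.trace (C * H ^ (2 * m₂) * Cᵀ)

/-- The even-exponent pairing is a Hilbert–Schmidt square, hence nonnegative (tilted torus = exact RP). PROVED. -/
theorem trace_conj_even_pow_nonneg (H C : Matrix (Fin d) (Fin d) ℝ) (hH : Hᵀ = H) (j : ℕ) :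
    0 ≤ Matrix.trace (C * H ^ (2 * j) * Cᵀ) := by
  have hsym : (H ^ j)ᵀ = H ^ j := by rw [Matrix.transpose_pow, hH]
  have : C * H ^ (2 * j) * Cᵀ = (C * H ^ j) * (C * H ^ j)ᵀ := by
    rw [Matrix.transpose_mul, hsym, two_mul, pow_add]
    simp only [Matrix.mul_assoc]
  rw [this]
  set M := C * H ^ j with hM
  simp only [Matrix.trace, Matrix.diag_apply, Matrix.mul_apply, Matrix.transpose_apply]
  exact Finset.sum_nonneg fun i _ => Finset.sum_nonneg fun k _ => mul_self_nonneg _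

end WrongSign

section LimitTransfer
/-! ### 3. Transfer by inequality, not by limit-closure.
If the odd-torus pairings are `p_k − q_k` with `p_k ≥ 0` (right-sign part) and the wrong-sign parts `q_k → 0`
(residual (WS), fed by (★) + odd-twist gap + lukewarmness + tilted L² bounds), then the `hconv`-limit is `≥ 0`:
this is how `stub_diagonalProductRP`'s sign is produced for the continuum state from finite-torus data. PROVED. -/

theorem nonneg_of_tendsto_sub {p q : ℕ → ℝ} {x : ℝ} (hp : ∀ k, 0 ≤ p k)
    (hq : Tendsto q atTop (𝓝 0)) (h : Tendsto (fun k => p k - q k) atTop (𝓝 x)) : 0 ≤ x := by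
  have hpx : Tendsto p atTop (𝓝 x) := by
    have := h.add hq
    simpa using this
  exact ge_of_tendsto' hpx fun k => hp k

/-- liminf form actually needed (no rate): `p_k − q_k → x`, `p_k ≥ 0`, `q_k ≤ ε_k b_k` with `ε_k → 0` and `b_k`
bounded (tilted-torus second moments, residual R3) ⇒ `0 ≤ x`. PROVED. -/
theorem nonneg_of_dominated {p q ε b : ℕ → ℝ} {x B : ℝ} (hp : ∀ k, 0 ≤ p k) (hq0 : ∀ k, 0 ≤ q k)
    (hq : ∀ k, q k ≤ ε k * b k) (hb : ∀ k, |b k| ≤ B) (hε0 : ∀ k, 0 ≤ ε k)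
    (hε : Tendsto ε atTop (𝓝 0)) (h : Tendsto (fun k => p k - q k) atTop (𝓝 x)) : 0 ≤ x := by
  have hqt : Tendsto q atTop (𝓝 0) := by
    have hεB : Tendsto (fun k => ε k * B) atTop (𝓝 0) := by
      simpa using hε.mul_const B
    apply squeeze_zero (fun k => hq0 k) _ hεB
    intro k
    calc q k ≤ ε k * b k := hq k
      _ ≤ ε k * |b k| := by gcongr; exacts [hε0 k, le_abs_self _]
      _ ≤ ε k * B := by gcongr; exacts [hε0 k, hb k]
  exact nonneg_of_tendsto_sub hp hqt h

end LimitTransfer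

/-! ## A7. Sector traces of odd powers of the diagonal root are untwisted long-torus data

`K₁ := K * W ^ ((N+1)/2)` (the self-adjoint odd root of the e₀-step, `W` the unit mirror shift,
`W ^ N = 1`, `[K, W] = 0`).  For the powers `m = N * (2j+1)` the shift factor disappears:
`K₁ ^ m = K ^ m`, i.e. `Tr (Q * K₁ ^ m)` is a character transform of (twisted) partition functions of the
untwisted long torus `Λ_j`; Kanazawa's electric-flux positivity (arXiv:0808.3442, Lemma 2 (a4)) then
gives `0 ≤ Tr (Q * K₁ ^ m)` for transverse flux sectors, and `TopSignOfOddTraces` turns that into the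
sign of the sector's top eigenvalue (`SectorTopStateEven`). -/
section SectorTraces

/-- PROVED (pure algebra): the mirror-shift factor of the odd root drops out of every power
`N * (2j+1)` — these powers of `K₁` are powers of the untwisted e₀-step. (Oddness of `N` is needed
only for `K₁` to be symmetric, not here.) -/
theorem oddRoot_pow_eq {α : Type*} [Monoid α] (K W : α) (hKW : Commute K W) (N j : ℕ)
    (hW : W ^ N = 1) :
    (K * W ^ ((N + 1) / 2)) ^ (N * (2 * j + 1)) = K ^ (N * (2 * j + 1)) := by
  have hc : Commute K (W ^ ((N + 1) / 2)) := hKW.pow_right _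
  rw [hc.mul_pow, ← pow_mul]
  have : W ^ ((N + 1) / 2 * (N * (2 * j + 1))) = 1 := by
    have h : (N + 1) / 2 * (N * (2 * j + 1)) = N * ((N + 1) / 2 * (2 * j + 1)) := by ring
    rw [h, pow_mul, hW, one_pow]
  rw [this, mul_one]

/-- PROVED (elementary): if the weighted odd-power traces `∑ i, w i * κ i ^ (N*(2j+1))` are
nonnegative for all `j` (`N` odd), the weights are nonnegative, and `i₀` carries positive weight and
STRICTLY the largest modulus, then `κ i₀ ≥ 0` — the top state of the sector is right-signed. -/
theorem topSign_of_odd_traces {ι : Type*} [Fintype ι] [DecidableEq ι] (w κ : ι → ℝ) (i₀ : ι)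
    (N : ℕ) (hN : Odd N) (hw : ∀ i, 0 ≤ w i) (hw₀ : 0 < w i₀)
    (htop : ∀ i, i ≠ i₀ → |κ i| < |κ i₀|)
    (htr : ∀ j : ℕ, 0 ≤ ∑ i, w i * κ i ^ (N * (2 * j + 1))) : 0 ≤ κ i₀ := by
  by_contra hneg
  push Not at hneg
  set c := |κ i₀| with hc_def
  have hc : 0 < c := abs_pos.mpr hneg.ne
  -- ratios ρ i = |κ i| / c < 1 off i₀
  have hρ : ∀ i, i ≠ i₀ → |κ i| / c < 1 := fun i hi => (div_lt_one hc).mpr (htop i hi)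
  have hρ0 : ∀ i, 0 ≤ |κ i| / c := fun i => div_nonneg (abs_nonneg _) hc.le
  -- the off-diagonal sum tends to 0 along m → ∞
  have hlim : Tendsto (fun m : ℕ => ∑ i ∈ Finset.univ.erase i₀, w i * (|κ i| / c) ^ m)
      atTop (𝓝 0) := by
    have : (0 : ℝ) = ∑ i ∈ Finset.univ.erase i₀, w i * 0 := by simp
    rw [this]
    refine tendsto_finsetSum _ fun i hi => ?_
    refine Tendsto.const_mul _ ?_
    exact tendsto_pow_atTop_nhds_zero_of_lt_one (hρ0 i) (hρ i (Finset.ne_of_mem_erase hi))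
  -- pick m odd of the form N*(2j+1) with off-diagonal sum < w i₀
  have hev : ∀ᶠ m : ℕ in atTop, ∑ i ∈ Finset.univ.erase i₀, w i * (|κ i| / c) ^ m < w i₀ :=
    hlim.eventually (gt_mem_nhds hw₀)
  obtain ⟨M₀, hM₀⟩ := hev.exists_forall_of_atTop
  obtain ⟨n₀, hn₀⟩ := hN
  -- m := N * (2*M₀+1) ≥ M₀
  have hNpos : 1 ≤ N := by omega
  set m := N * (2 * M₀ + 1) with hm_def
  have hmM : M₀ ≤ m := by
    have : M₀ ≤ 2 * M₀ + 1 := by omega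
    calc M₀ ≤ 2 * M₀ + 1 := this
      _ = 1 * (2 * M₀ + 1) := by ring
      _ ≤ N * (2 * M₀ + 1) := Nat.mul_le_mul_right _ hNpos
  have hmodd : Odd m := by
    rw [hm_def, hn₀]; exact ⟨2 * n₀ * M₀ + n₀ + M₀, by ring⟩
  have hsmall := hM₀ m hmM
  have htrm := htr M₀
  -- rewrite the trace: split off i₀
  rw [← Finset.add_sum_erase _ _ (Finset.mem_univ i₀)] at htrm
  -- κ i₀ ^ m = - c ^ m (m odd, κ i₀ < 0)
  have hκ0 : κ i₀ ^ m = -(c ^ m) := by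
    have : κ i₀ = -c := by rw [hc_def, abs_of_neg hneg]; ring
    rw [this, Odd.neg_pow hmodd]
  -- bound the rest: w i * κ i ^ m ≤ w i * |κ i| ^ m = w i * (|κ i|/c)^m * c^m
  have hrest : ∑ i ∈ Finset.univ.erase i₀, w i * κ i ^ m
      ≤ c ^ m * ∑ i ∈ Finset.univ.erase i₀, w i * (|κ i| / c) ^ m := by
    rw [Finset.mul_sum]
    refine Finset.sum_le_sum fun i _ => ?_
    have h1 : κ i ^ m ≤ |κ i| ^ m := by
      calc κ i ^ m ≤ |κ i ^ m| := le_abs_self _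
        _ = |κ i| ^ m := abs_pow _ _
    have h2 : |κ i| ^ m = c ^ m * (|κ i| / c) ^ m := by
      rw [div_pow, mul_div_cancel₀ _ (pow_ne_zero _ hc.ne')]
    calc w i * κ i ^ m ≤ w i * |κ i| ^ m := mul_le_mul_of_nonneg_left h1 (hw i)
      _ = c ^ m * (w i * (|κ i| / c) ^ m) := by rw [h2]; ring
  have hcm : 0 < c ^ m := pow_pos hc _
  have : w i₀ * κ i₀ ^ m + ∑ i ∈ Finset.univ.erase i₀, w i * κ i ^ m < 0 := by
    rw [hκ0]
    have := mul_lt_mul_of_pos_left hsmall hcm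
    nlinarith
  linarith

end SectorTraces

end Summit.QuantumFields.YangMills.Cruxes.DiagonalMirrorRPR.WrongSignAnnex
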